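import Summits.AnomalousDissipation.AnomalousDissipation.Theorems.SolenoidalFractalHomogenisationLagrangianStepVmodFfCoarseLong
import Summits.AnomalousDissipation.AnomalousDissipation.Theorems.SolenoidalFractalHomogenisationLagrangianStepVmodFfCoarseMid
import Summits.AnomalousDissipation.AnomalousDissipation.Theorems.SolenoidalFractalHomogenisationLagrangianStepVmodSfCoarseDispatch
import HarnessLib

/-!
# K1L_D (stmt-AnomalousDissipation-27980): (V_mod) flat stage, block (ff) — THE COARSE-LABEL DISPATCH at grid phase (long windows, FAST class
# datum), constants as hypotheses (prover ad-k3l-bookkeeping-p1 g10; RULING D28-9 / D28-17 (a) assign the (ff) grid twin to k3l; helper `--supports 27980`)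

The (ff) twin of `…VmodSfCoarseDispatch.pairing_le_alw_dispatch_coarse` (p724078): LONG windows (`M·W.period/ν < t − s`), grid start
`s = j₀·(M·W.period/ν)`, COARSE nonzero slow labels (`‖ℓ‖⌈K/ν⌉ ≤ g₀·n`), a weakly divergence-free FAST CLASS datum `w` (`𝓕w ⊆ ±ℓ + nℤ³`,
`𝓕w(±ℓ) = 0`), a fast test `ζ`.  Three leaves: `Rτ ≤ 2` → MID row `sideband_le_alw_of_mid_fast`; `Rτ > 2`, `t₀ ≤ ν` → ν-FLOOR row
`sideband_le_alw_of_nufloor_fast`; `Rτ > 2`, `ν < t₀` → p1's `coarse_smallness` (p717612) feeds the LONG row `sideband_le_alw_of_scale_iter_fast`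
(p727808).  The pairing is reduced to the sideband by `abs_inner_le_sideband_mul_norm` (fast test ⊥ the pair `{±ℓ}`):

  `|⟪U s t w, ζ⟫| ≤ (C₁(C₁(ν^e + (⌈K/ν⌉/n)^e) + (min 1 (P/τ))^e)) · ‖w‖ · ‖ζ‖`   (`pairing_le_alw_dispatch_coarse_fast`).

The constants (`g₀`, `t₀`, `C₁`) are CHOSEN in the companion `…VmodFfModeGrid`.  `sorry`-free; NOT a proof of (ff), of the stub, of K1L_D or
of AD; rung F-D1.A0.
-/

set_option linter.dupNamespace false

noncomputable section

namespace Summit.AnomalousDissipation.AnomalousDissipation.Theorems.SolenoidalFractalHomogenisation.LagrangianStep.VmodGen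

open Set MeasureTheory Complex UnitAddTorus
open scoped InnerProductSpace ENNReal
open Literature.Analysis Literature.Analysis.FunctionSpaces Literature.Analysis.FunctionSpaces.Torus
open Literature.Analysis.FluidPDE Literature.Analysis.FluidPDE.Torus Literature.Analysis.FluidPDE.LatticeShear
open Summit.AnomalousDissipation.AnomalousDissipation.Theorems.SolenoidalFractalHomogenisation.LagrangianStep.Sideband (slotAmp)
open Summit.AnomalousDissipation.AnomalousDissipation.Theorems.SolenoidalFractalHomogenisation.LagrangianStep.VmodFlat (fc loT dW IsFast)

/-! ## The coarse dispatch, fast class datum -/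

section Clause

variable {k : ℕ} {W : LatticeWord k} {M : ℝ} {hM : 0 < M} {c : ℝ}
  {Φ : ℝ → Visc4 (Fin 3) → Visc4 (Fin 3)} {lo hi Λ β σ C ν₀ K : ℝ}
  {ν : ℝ} {n : ℕ} {𝔸 : Visc4 (Fin 3)} {Tw : ℝ} {U T : ℝ → ℝ → (V2 →L[ℝ] V2)}

set_option maxHeartbeats 3200000 in
/-- **THE COARSE-LABEL DISPATCH OF (ff)** (grid start, long window, fast class datum, fast test; constants as hypotheses).  See the module docstring. -/
theorem pairing_le_alw_dispatch_coarse_fast (hV : SlowVectorClauseF W M hM c Φ lo hi Λ β σ C ν₀ K)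
    (hlo : 0 < lo) (hhi : 1 ≤ hi) (hΛ : 1 < Λ) (hσ : 0 < σ) (hC : 0 ≤ C) (hν₀1 : ν₀ ≤ 1) (hK : 0 < K) (hc : 0 < c)
    {e : ℝ} (he0 : 0 < e) (he12 : e ≤ 1 / 2)
    {g₀ t₀ C₁ : ℝ} (hg₀0 : 0 < g₀) (hg₀1 : g₀ ≤ 1)
    (hgσ : 2 * Real.sqrt 2 * C ^ 2 * g₀ ^ σ ≤ 1 / 50) (ht₀0 : 0 < t₀) (hνcσ : 2 * Real.sqrt 2 * C ^ 2 * t₀ ^ σ ≤ 1 / 50)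
    (hAg : (8 * Real.pi ^ 2 * (lo / Λ) * (M * W.period) * (1 + c) / K ^ 2) * g₀ ≤ (1 / (50 * (2 * Real.sqrt 2 * C * (hi * Λ ^ 2 / lo) + 1))))
    (hBg : (12 * k * Real.exp (9 * (k : ℝ) ^ 2 / (2 * Real.pi ^ 4 * (lo / Λ) ^ 2 * c)) / (Real.pi ^ 2 * (lo / Λ) * K)) * g₀ ≤ 1 / 50)
    (hBsg : (24 * (∑ j, ‖slotAmp W j‖) / (Real.pi * (lo / Λ) * K)) * g₀ ≤ 1 / 50)
    (hgd : 16 * (1 + c) * g₀ / K ^ 2 ≤ 1 / 50)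
    (hC₁0 : 0 ≤ C₁)
    (hC₁m : Real.sqrt 2 * (8 * (∑ j, ‖slotAmp W j‖) / (Real.pi * (lo / Λ) * Real.sqrt (8 * Real.pi ^ 2 * (lo / Λ) * (M * W.period) * c)))
      + 1 / Real.sqrt (Real.pi ^ 2 * (lo / Λ) * (M * W.period) / 2) ≤ C₁)
    (hC₁f : 4 * (∑ j, ‖slotAmp W j‖) / (Real.pi * (lo / Λ) * t₀) ≤ C₁ * C₁ * t₀ ^ e)
    (hC₁k : 1 / Real.sqrt (Real.pi ^ 2 * (lo / Λ) * (M * W.period) / 2) ≤ C₁)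
    (hC₁s : 8750 * (8 * (∑ j, ‖slotAmp W j‖) / (Real.pi * (lo / Λ) * Real.sqrt (8 * Real.pi ^ 2 * (lo / Λ) * (M * W.period) * c)))
      + 4240 / (Real.pi ^ 2 * (lo / Λ) * (M * W.period) / 2) ^ 2 ≤ C₁)
    (hν : ν ∈ Set.Ioo 0 ν₀) (hn : (⌈K / ν⌉₊ : ℝ) ≤ n) (hodd : OddSmall 𝔸 (ν * β))
    (hwin : ∃ lam ∈ Set.Icc (1:ℝ) Λ, NearIso 𝔸 (ν * (lo / lam)) (ν * (hi * lam)))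
    (hΦw : ∃ lam ∈ Set.Icc (1:ℝ) Λ, NearIso (Φ ν ((1 / ν) • 𝔸)) (lo / lam) (hi * lam))
    (hU : IsPropagator Tw (cellField W M hM ν hν.1 n) ((1 / (n:ℝ) ^ 2) • 𝔸) U)
    (hT : IsPropagator Tw (fun (_ : ℝ) (_ : UnitAddTorus (Fin 3)) => (0 : EuclideanSpace ℝ (Fin 3)))
      ((1 / (n:ℝ) ^ 2) • (𝔸 + (c / ν) • Φ ν ((1 / ν) • 𝔸))) T)
    {s t : ℝ} (hst : s < t) (htT : t ≤ Tw) (j₀ : ℕ) (hs₀ : s = j₀ * (M * W.period / ν)) (hPτ : M * W.period / ν < t - s)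
    {ℓ : Fin 3 → ℤ} (hℓ : ℓ ∈ (Torus.freqBall (d := Fin 3) (n / 4)).erase 0) (hco : ‖Torus.latticeVec ℓ‖ * (⌈K / ν⌉₊ : ℝ) ≤ g₀ * n)
    (w : V2) (hw : w ∈ divFreeL2 (Fin 3))
    (hwcl : ∀ k', fc w k' ≠ 0 → (∀ i, (n : ℤ) ∣ k' i - ℓ i) ∨ (∀ i, (n : ℤ) ∣ k' i + ℓ i)) (hw1 : fc w ℓ = 0) (hw2 : fc w (-ℓ) = 0)
    (ζ : V2) (hζ : IsFast n ζ) :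
    |⟪U s t w, ζ⟫_ℝ|
      ≤ (C₁ * (C₁ * (ν ^ e + ((⌈K / ν⌉₊ : ℝ) / n) ^ e) + (min 1 ((M * W.period / ν) / (t - s))) ^ e)) * ‖w‖ * ‖ζ‖ := by
  have hΛ1 : 1 ≤ Λ := hΛ.le
  have hhi0 : 0 ≤ hi := by linarith only [hhi]
  have hν1 : ν ≤ 1 := hν.2.le.trans hν₀1
  have hceil1 : (1:ℝ) ≤ (⌈K / ν⌉₊ : ℝ) := by
    exact_mod_cast Nat.one_le_iff_ne_zero.2 (Nat.pos_iff_ne_zero.1 (Nat.ceil_pos.2 (div_pos hK hν.1)))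
  have hn1 : 1 ≤ n := by exact_mod_cast (hceil1.trans hn)
  have hn0 : (0:ℝ) < n := by exact_mod_cast (show 0 < n from hn1)
  obtain ⟨hℓ0, hℓB⟩ := Finset.mem_erase.1 hℓ
  have hLb : 2 * (n / 4) < n := by omega
  have hscale : ‖Torus.latticeVec ℓ‖ * (⌈K / ν⌉₊ : ℝ) ≤ n := hco.trans (by nlinarith only [hg₀1, hn0])
  -- the sideband controls the pairing with a fast test
  have hUw : U s t w ∈ divFreeL2 (Fin 3) := (mem_divFreeL2_iff _).2 (hU.divFree s t w)
  have hpair := VmodGen.abs_inner_le_sideband_mul_norm hℓ0 hℓB (U s t w) hUw ζ hζ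
  refine hpair.trans (mul_le_mul_of_nonneg_right ?_ (norm_nonneg _))
  -- ### the dispatch on the window length and on ν
  by_cases hR2 : 8 * Real.pi ^ 2 * loT lo Λ c ν n * Torus.freqNormSq ℓ * (t - s) ≤ 2
  · exact sideband_le_alw_of_mid_fast hlo hhi0 hΛ1 hc hν hn1 hwin hU j₀ hs₀ htT hLb hℓ0 hℓB w hw hwcl hw1 hw2 hC₁0 hC₁m he12 hPτ hR2
  · rw [not_le] at hR2
    by_cases hνc : t₀ ≤ ν
    · exact sideband_le_alw_of_nufloor_fast hlo hhi0 hΛ1 hν hn1 hwin hU j₀ hs₀ htT hLb hℓ0 hℓB w hw hwcl hw1 hw2 hC₁0 ht₀0 hνc he0.le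
        he12 hC₁f hC₁k hPτ
    · rw [not_le] at hνc
      obtain ⟨hRP, hρ⟩ := coarse_smallness W hC hσ hc hlo hhi0 hΛ1 hM hν.1 hν1 hK hn1 hℓ0 hg₀0 hg₀1 hνc.le hco hgσ hνcσ
        hAg hBg hBsg hgd
      exact sideband_le_alw_of_scale_iter_fast hV hlo hhi0 hΛ1 hc hC hK.le hν hn1 hodd hwin hΦw hU hT j₀ hs₀ hst htT hLb hℓ0 hℓB
        hscale w hw hwcl hw1 hw2 hC₁0 hC₁s he12 hρ hRP hR2.le

end Clause

end Summit.AnomalousDissipation.AnomalousDissipation.Theorems.SolenoidalFractalHomogenisation.LagrangianStep.VmodGen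

end
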